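import Mathlib
import Literature.Analysis.FluidPDE.Tao2016AveragedNS.ShiftSetCascadeFlows
import Literature.Analysis.FluidPDE.Tao2016AveragedNS.ShiftSetCascadeFlux
import Summits.NavierStokesRegularity.NavierStokesRegularity.Theorems.TaoLadderRungTwoFlatCertificateGlueFieldBoundsOn
import Summits.NavierStokesRegularity.NavierStokesRegularity.Theorems.TaoLadderRungTwoFlatCertificateGlueFlowTubeOn
import HarnessLib

/-!
# Certificate glue on a shift set `𝕊`, XV-c: TABLE-FORM BOUNDS WITH PER-COMPONENT WEIGHTS — the weighted Lipschitz
  constant and the input defect of the window field for a weight table `ω : Fin m → ℤ → ℝ` from FINITE SUMS over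
  the structure table (helper for items stmt-NavierStokesRegularity-22987 `FlatGapCertificatesV2` (crux K_A♭ of route
  TaoLadderRungTwoFlat) and stmt-24295 K_A₂(64); cell harvest/h2-tao-ladder, p1 g15; theory-1 ruling R6a)

Glue XIV-c (`stepCert_of_flowTube`) and XX-c (`stepCert_of_chainCert`) consume `PFieldLipOn ω G K` and
`PInputDefectOn ω G δ` — each a `∀` over a box of states, with one weight per window COMPONENT. As glue XV did for
per-shell weights, this module reduces both to ONE FINITE INEQUALITY PER WINDOW COMPONENT `(i, k)`:

* `pfieldLipOn_of_table` — `Σ |α| c (Ĝ_{i₁}(a) ω̂_{i₂}(b) + ω̂_{i₁}(a) Ĝ_{i₂}(b)) ≤ K ω i k` ⇒ `PFieldLipOn` (any `𝕊`);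
* `pinputDefectOn_of_table` — `Σ_{a or b off the window} |α| c Ĝ⁺_{i₁}(a) Ĝ⁺_{i₂}(b) ≤ δ ω i k` ⇒ `PInputDefectOn`
  (nearest-neighbour `𝕊`);
* `inBoxOn_of_near_box` — the componentwise comparison behind the hull / node inclusions of glue XIV-c / XX-c when
  hulls and nodes are boxes;

with `Ĝ = boxSup`, `Ĝ⁺ = boxSupIn` (glue XV) and `ω̂ = pwExt` the zero-extended per-component weight,
`a = k − μ₃ + μ₁`, `b = k − μ₃ + μ₂`, `c = (1+ε₀)^{5(k−μ₃)/2}`. Proofs = glue XV's with `ω̂(n)` replaced by `ω̂ i n`.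

HONEST FRAMING: Tao-type MODEL lattices (Tao 2016 §4/§6 vocabulary, shift-set parametrised); inequalities about an
explicit polynomial field, nothing certified, no stub closed, nothing about the Navier–Stokes equations.
-/

noncomputable section

-- the sub-problem namespace repeats the summit name by design (D-0017)
set_option linter.dupNamespace false

namespace Summit.NavierStokesRegularity.NavierStokesRegularity.Theorems

open Set Literature.Analysis.FluidPDE Literature.Analysis.FluidPDE.TaoCascade

namespace CertificateGlueOn

variable {m : ℕ} {Kb Ka : ℤ} {ω : Fin m → ℤ → ℝ}

/-! ### Table-form bounds with per-component weights -/

section PerCompTable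

open Finset

variable {𝕊 : Finset (ℤ × ℤ × ℤ)} {ε₀ : ℝ} {α : Fin m → Fin m → Fin m → ℤ × ℤ × ℤ → ℝ} {Eb Et : ℝ}
  {lo hi : Fin m → ℤ → ℝ}

/-- Zero-extended per-component weight `ω̂ i n` (`ω i n` on the window, `0` outside). [folklore] -/
def pwExt (Kb Ka : ℤ) (ω : Fin m → ℤ → ℝ) (i : Fin m) (n : ℤ) : ℝ := if -Kb ≤ n ∧ n ≤ Ka then ω i n else 0

/-- The zero-extended per-component weight is nonnegative for nonnegative weights. [folklore] -/
theorem pwExt_nonneg (hω0 : ∀ i k, 0 ≤ ω i k) (i : Fin m) (n : ℤ) : 0 ≤ pwExt Kb Ka ω i n := by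
  unfold pwExt; split_ifs
  · exact hω0 i n
  · exact le_rfl

/-- Differences of truncated states are bounded by `D ω̂ i n`. [folklore] -/
theorem abs_trunc_sub_le_pw {Y Y' : Fin m → ℤ → ℝ} {D : ℝ}
    (hD : ∀ i k, -Kb ≤ k → k ≤ Ka → |Y i k - Y' i k| ≤ D * ω i k) (i : Fin m) (n : ℤ) :
    |(if -Kb ≤ n ∧ n ≤ Ka then Y i n else 0) - (if -Kb ≤ n ∧ n ≤ Ka then Y' i n else 0)| ≤
      D * pwExt Kb Ka ω i n := by
  unfold pwExt
  split_ifs with hn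
  · exact hD i n hn.1 hn.2
  · simp

/-- One term of the per-component Lipschitz estimate. [folklore] -/
theorem lip_term_pw (hω0 : ∀ i k, 0 ≤ ω i k) {Y Y' : Fin m → ℤ → ℝ} {D : ℝ} (hD : 0 ≤ D)
    (hY : InBoxOn Kb Ka lo hi Y) (hY' : InBoxOn Kb Ka lo hi Y')
    (hdiff : ∀ i k, -Kb ≤ k → k ≤ Ka → |Y i k - Y' i k| ≤ D * ω i k) (i₁ i₂ : Fin m) (a b : ℤ) :
    |(if -Kb ≤ a ∧ a ≤ Ka then Y i₁ a else 0) * (if -Kb ≤ b ∧ b ≤ Ka then Y i₂ b else 0) -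
        (if -Kb ≤ a ∧ a ≤ Ka then Y' i₁ a else 0) * (if -Kb ≤ b ∧ b ≤ Ka then Y' i₂ b else 0)| ≤
      D * (boxSup Kb Ka lo hi i₁ a * pwExt Kb Ka ω i₂ b + pwExt Kb Ka ω i₁ a * boxSup Kb Ka lo hi i₂ b) := by
  have h1 := abs_trunc_le_boxSup hY i₁ a
  have h2 := abs_trunc_le_boxSup hY' i₂ b
  have h3 := abs_trunc_sub_le_pw (Kb := Kb) (Ka := Ka) (ω := ω) hdiff i₁ a
  have h4 := abs_trunc_sub_le_pw (Kb := Kb) (Ka := Ka) (ω := ω) hdiff i₂ b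
  have hG1 := boxSup_nonneg (Kb := Kb) (Ka := Ka) (lo := lo) (hi := hi) i₁ a
  have hwa := pwExt_nonneg (Kb := Kb) (Ka := Ka) hω0 i₁ a
  refine (abs_mul_sub_mul_le _ _ _ _).trans ?_
  calc _ ≤ boxSup Kb Ka lo hi i₁ a * (D * pwExt Kb Ka ω i₂ b) + D * pwExt Kb Ka ω i₁ a * boxSup Kb Ka lo hi i₂ b :=
        add_le_add (mul_le_mul h1 h4 (abs_nonneg _) hG1)
          (mul_le_mul h3 h2 (abs_nonneg _) (mul_nonneg hD hwa))
    _ = D * (boxSup Kb Ka lo hi i₁ a * pwExt Kb Ka ω i₂ b + pwExt Kb Ka ω i₁ a * boxSup Kb Ka lo hi i₂ b) := by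
        ring

/-- **PER-COMPONENT WEIGHTED LIPSCHITZ CONSTANT FROM THE TABLE**: if for every window component `(i,k)`
`Σ_{i₁,i₂,μ} |α i₁ i₂ i μ| (1+ε₀)^{5(k−μ₃)/2} (Ĝ_{i₁}(a) ω̂_{i₂}(b) + ω̂_{i₁}(a) Ĝ_{i₂}(b)) ≤ K ω i k` then
`PFieldLipOn … ω lo hi K` (glue XIV-c). [cite: MooreKearfottCloud2009, §6.2–6.4 (interval enclosures of ranges); cell certificate format, box layer] -/
theorem pfieldLipOn_of_table (hε : 0 < 1 + ε₀) (hω0 : ∀ i k, 0 ≤ ω i k) {K : ℝ}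
    (htab : ∀ i k, -Kb ≤ k → k ≤ Ka →
      ∑ i₁ : Fin m, ∑ i₂ : Fin m, ∑ μ ∈ 𝕊,
        |α i₁ i₂ i μ| * (1 + ε₀) ^ ((5 : ℝ) * (k - μ.2.2) / 2) *
          (boxSup Kb Ka lo hi i₁ (k - μ.2.2 + μ.1) * pwExt Kb Ka ω i₂ (k - μ.2.2 + μ.2.1) +
            pwExt Kb Ka ω i₁ (k - μ.2.2 + μ.1) * boxSup Kb Ka lo hi i₂ (k - μ.2.2 + μ.2.1)) ≤ K * ω i k) :
    PFieldLipOn 𝕊 ε₀ α Kb Ka ω lo hi K := by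
  intro Y Y' D hD hY hY' hdiff i k hk1 hk2
  unfold truncField quadTermOn
  rw [← Finset.sum_sub_distrib]
  refine (Finset.abs_sum_le_sum_abs _ _).trans ?_
  have hterm : ∀ (i₁ i₂ : Fin m) (μ : ℤ × ℤ × ℤ),
      |α i₁ i₂ i μ * (1 + ε₀) ^ ((5 : ℝ) * (k - μ.2.2) / 2) *
          ((if -Kb ≤ k - μ.2.2 + μ.1 ∧ k - μ.2.2 + μ.1 ≤ Ka then Y i₁ (k - μ.2.2 + μ.1) else 0) *
            (if -Kb ≤ k - μ.2.2 + μ.2.1 ∧ k - μ.2.2 + μ.2.1 ≤ Ka then Y i₂ (k - μ.2.2 + μ.2.1) else 0)) -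
        α i₁ i₂ i μ * (1 + ε₀) ^ ((5 : ℝ) * (k - μ.2.2) / 2) *
          ((if -Kb ≤ k - μ.2.2 + μ.1 ∧ k - μ.2.2 + μ.1 ≤ Ka then Y' i₁ (k - μ.2.2 + μ.1) else 0) *
            (if -Kb ≤ k - μ.2.2 + μ.2.1 ∧ k - μ.2.2 + μ.2.1 ≤ Ka then Y' i₂ (k - μ.2.2 + μ.2.1) else 0))| ≤
      D * (|α i₁ i₂ i μ| * (1 + ε₀) ^ ((5 : ℝ) * (k - μ.2.2) / 2) *
          (boxSup Kb Ka lo hi i₁ (k - μ.2.2 + μ.1) * pwExt Kb Ka ω i₂ (k - μ.2.2 + μ.2.1) +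
            pwExt Kb Ka ω i₁ (k - μ.2.2 + μ.1) * boxSup Kb Ka lo hi i₂ (k - μ.2.2 + μ.2.1))) := by
    intro i₁ i₂ μ
    have hc : 0 ≤ (1 + ε₀) ^ ((5 : ℝ) * (k - μ.2.2) / 2) := (Real.rpow_pos_of_pos hε _).le
    rw [← mul_sub, abs_mul, abs_mul, abs_of_nonneg hc]
    have hb := lip_term_pw hω0 hD hY hY' hdiff i₁ i₂ (k - μ.2.2 + μ.1) (k - μ.2.2 + μ.2.1)
    calc |α i₁ i₂ i μ| * (1 + ε₀) ^ ((5 : ℝ) * (k - μ.2.2) / 2) * _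
        ≤ |α i₁ i₂ i μ| * (1 + ε₀) ^ ((5 : ℝ) * (k - μ.2.2) / 2) *
          (D * (boxSup Kb Ka lo hi i₁ (k - μ.2.2 + μ.1) * pwExt Kb Ka ω i₂ (k - μ.2.2 + μ.2.1) +
            pwExt Kb Ka ω i₁ (k - μ.2.2 + μ.1) * boxSup Kb Ka lo hi i₂ (k - μ.2.2 + μ.2.1))) :=
          mul_le_mul_of_nonneg_left hb (mul_nonneg (abs_nonneg _) hc)
      _ = _ := by ring
  have step : ∀ i₁ : Fin m,
      |∑ i₂ : Fin m, ∑ μ ∈ 𝕊, α i₁ i₂ i μ * (1 + ε₀) ^ ((5 : ℝ) * (k - μ.2.2) / 2) *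
          ((if -Kb ≤ k - μ.2.2 + μ.1 ∧ k - μ.2.2 + μ.1 ≤ Ka then Y i₁ (k - μ.2.2 + μ.1) else 0) *
            (if -Kb ≤ k - μ.2.2 + μ.2.1 ∧ k - μ.2.2 + μ.2.1 ≤ Ka then Y i₂ (k - μ.2.2 + μ.2.1) else 0)) -
        ∑ i₂ : Fin m, ∑ μ ∈ 𝕊, α i₁ i₂ i μ * (1 + ε₀) ^ ((5 : ℝ) * (k - μ.2.2) / 2) *
          ((if -Kb ≤ k - μ.2.2 + μ.1 ∧ k - μ.2.2 + μ.1 ≤ Ka then Y' i₁ (k - μ.2.2 + μ.1) else 0) *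
            (if -Kb ≤ k - μ.2.2 + μ.2.1 ∧ k - μ.2.2 + μ.2.1 ≤ Ka then Y' i₂ (k - μ.2.2 + μ.2.1) else 0))| ≤
      D * ∑ i₂ : Fin m, ∑ μ ∈ 𝕊, |α i₁ i₂ i μ| * (1 + ε₀) ^ ((5 : ℝ) * (k - μ.2.2) / 2) *
          (boxSup Kb Ka lo hi i₁ (k - μ.2.2 + μ.1) * pwExt Kb Ka ω i₂ (k - μ.2.2 + μ.2.1) +
            pwExt Kb Ka ω i₁ (k - μ.2.2 + μ.1) * boxSup Kb Ka lo hi i₂ (k - μ.2.2 + μ.2.1)) := by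
    intro i₁
    rw [← Finset.sum_sub_distrib, Finset.mul_sum]
    refine (Finset.abs_sum_le_sum_abs _ _).trans (Finset.sum_le_sum fun i₂ _ => ?_)
    rw [← Finset.sum_sub_distrib, Finset.mul_sum]
    exact (Finset.abs_sum_le_sum_abs _ _).trans (Finset.sum_le_sum fun μ _ => hterm i₁ i₂ μ)
  refine (Finset.sum_le_sum fun i₁ _ => step i₁).trans ?_
  rw [← Finset.mul_sum]
  calc D * _ ≤ D * (K * ω i k) := mul_le_mul_of_nonneg_left (htab i k hk1 hk2) hD
    _ = K * D * ω i k := by ring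

/-- **PER-COMPONENT INPUT DEFECT FROM THE TABLE** (nearest-neighbour `𝕊`): if for every window component `(i,k)`
`Σ_{i₁,i₂,μ : a or b off the window} |α i₁ i₂ i μ| (1+ε₀)^{5(k−μ₃)/2} Ĝ⁺_{i₁}(a) Ĝ⁺_{i₂}(b) ≤ δ ω i k` then
`PInputDefectOn … ω lo hi δ` (glue XIV-c). For the nearest-neighbour window systems only the components reading an
edge shell (`k = -Kb` or `k = Ka`) carry a nonzero left side. [cite: MooreKearfottCloud2009, §6.2–6.4 (interval enclosures of ranges); cell certificate format, box layer] -/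
theorem pinputDefectOn_of_table (h𝕊 : IsNearestNeighbourSet 𝕊) (hε : 0 < 1 + ε₀) {δ : ℝ}
    (htab : ∀ i k, -Kb ≤ k → k ≤ Ka →
      ∑ i₁ : Fin m, ∑ i₂ : Fin m, ∑ μ ∈ 𝕊,
        |α i₁ i₂ i μ| * (1 + ε₀) ^ ((5 : ℝ) * (k - μ.2.2) / 2) *
          (if (-Kb ≤ k - μ.2.2 + μ.1 ∧ k - μ.2.2 + μ.1 ≤ Ka) ∧ (-Kb ≤ k - μ.2.2 + μ.2.1 ∧ k - μ.2.2 + μ.2.1 ≤ Ka)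
            then 0
            else boxSupIn Kb Ka Eb Et lo hi i₁ (k - μ.2.2 + μ.1) *
              boxSupIn Kb Ka Eb Et lo hi i₂ (k - μ.2.2 + μ.2.1)) ≤ δ * ω i k) :
    PInputDefectOn 𝕊 ε₀ α Kb Ka Eb Et ω lo hi δ := by
  intro Y hY hb ht i k hk1 hk2
  unfold truncField quadTermOn
  rw [← Finset.sum_sub_distrib]
  refine (Finset.abs_sum_le_sum_abs _ _).trans ?_
  refine le_trans (Finset.sum_le_sum fun i₁ _ => ?_) (htab i k hk1 hk2)
  rw [← Finset.sum_sub_distrib]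
  refine (Finset.abs_sum_le_sum_abs _ _).trans (Finset.sum_le_sum fun i₂ _ => ?_)
  rw [← Finset.sum_sub_distrib]
  refine (Finset.abs_sum_le_sum_abs _ _).trans (Finset.sum_le_sum fun μ hμ => ?_)
  obtain ⟨h1, h2, h3⟩ := h𝕊 μ hμ
  have hc : 0 ≤ (1 + ε₀) ^ ((5 : ℝ) * (k - μ.2.2) / 2) := (Real.rpow_pos_of_pos hε _).le
  rw [← mul_sub, abs_mul, abs_mul, abs_of_nonneg hc]
  refine mul_le_mul_of_nonneg_left ?_ (mul_nonneg (abs_nonneg _) hc)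
  exact defect_term hY hb ht i₁ i₂ (by omega) (by omega) (by omega) (by omega)

/-- **Hull / region inclusion of a fattened box**: if `[Hlo − A ω, Hhi + A ω] ⊆ [glo, ghi]`-type comparisons hold
componentwise, every state within `A·ω` of a state of the box `[Hlo, Hhi]` lies in the target box — the finite
check behind the hypotheses `hH` / `hN'` of glue XIV-c / XX-c when hulls and nodes are boxes. [folklore] -/
theorem inBoxOn_of_near_box {Hlo Hhi Glo Ghi : Fin m → ℤ → ℝ} {A : ℝ}
    (hcmp : ∀ i k, -Kb ≤ k → k ≤ Ka → Glo i k ≤ Hlo i k - A * ω i k ∧ Hhi i k + A * ω i k ≤ Ghi i k)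
    {y p : Fin m → ℤ → ℝ} (hp : InBoxOn Kb Ka Hlo Hhi p)
    (hnear : ∀ i k, -Kb ≤ k → k ≤ Ka → |y i k - p i k| ≤ A * ω i k) : InBoxOn Kb Ka Glo Ghi y := by
  intro i k hk1 hk2
  have h1 := hcmp i k hk1 hk2
  have h2 := hp i k hk1 hk2
  have h3 := abs_le.mp (hnear i k hk1 hk2)
  constructor <;> linarith [h1.1, h1.2, h2.1, h2.2, h3.1, h3.2]

end PerCompTable

end CertificateGlueOn

end Summit.NavierStokesRegularity.NavierStokesRegularity.Theorems

end
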